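import Summits.BirchSwinnertonDyer.BirchSwinnertonDyer.Theorems.ManinLocalTwoThreeUnitTwistForcesPlusIndex

/-!
# FOURIER DUALITY in the `q`-tower, converse direction: a UNIT twisted value at a primitive character of conductor `qⁿ` forces a
# level-`n` tower difference with plus part `≢ 0 (mod p)` (MEMO-an §71.3 «⟹»; cell bsd-f2-manin, analytic lens g29)

Summit `BirchSwinnertonDyer`, route `ManinLocalTwoThree`, cruxes C3 `ManinPrimeToThreeAtNine` (stmt-BirchSwinnertonDyer-22968) / C2
`ManinOddAtFour` (stmt-…-22967).  `…TowerDescent` proved: tower differences not all `≡ 0 (mod p·Ω⁺)` ⟹ a primitive even unit twist of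
conductor `qⁿ`.  This file proves the converse at a fixed level `n ≥ 2`, so that the f-specific law E-an-135 (`KatoCurve.TowerUnitTwist p`)
is EQUIVALENT, level by level, to the character-free lattice statement «the plus coordinates `φ⁺({∞,(b+tq^{n-1})/qⁿ} − {∞,b/qⁿ})` are not all
divisible by `p`» — the quantity the cell's census tabulates (HOME/an/g29/TOWER-an-g29-*.txt, D-an-26):

* `exists_levelDifference_plus_not_dvd_of_unitTwist` — `f` a rational newform on `Γ₀(N)`, `q ∤ N` an odd prime, `q ≠ p`, `n ≥ 2`, `χ`
  PRIMITIVE and EVEN mod `qⁿ` with `Σ_a χ(a){∞, a/qⁿ}_f = r·Ω⁺_f` and `s·r/p` never an algebraic integer (`p ∤ s`) ⟹ some level-`n`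
  difference `{∞, (b + t q^{n-1})/qⁿ}_f − {∞, b/qⁿ}_f`, `q ∤ b`, has plus part `j·Ω⁺_f` with `p ∤ j`.

PROOF.  If all level-`n` plus parts were `≡ 0 (mod p)`, the even integer function `F(a) = ({∞,a/qⁿ} − {∞,0} + conj)/Ω⁺` would be constant
mod `p` along `a ↦ u_t·a`, `u_t = 1 + t q^{n-1}` (`u_s u_t = u_{s+t}` as `n ≥ 2`).  Averaging over `t < q`:
`q·F̂(χ) = Σ_a χ(a) Σ_t χ(u_t)(F(u_t a) − F(a))` because `Σ_{t<q} χ(u_t) = 0` — `χ(u_1) ≠ 1` for a PRIMITIVE `χ` (else `χ` kills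
`ker((ℤ/qⁿ)ˣ → (ℤ/q^{n-1})ˣ)` and factors through `q^{n-1}`) and `χ(u_1)^q = χ(u_q) = 1`.  So `q·F̂(χ) = p·Σ_a h(a)` with `h` even, integral,
vanishing off the units; pairing `a ↔ −a` makes the sum `2G`, `G` integral; with `2·S_χ = Ω⁺·F̂(χ)`: `q·r = p·G`, i.e. `q·r/p` is integral.

HONEST FRAMING: bookkeeping dual to `…TowerDescent`; nothing about Manin's conjecture or BSD is asserted.  No definitions.
-/

set_option linter.dupNamespace false
set_option autoImplicit false

noncomputable section

open scoped Classical MatrixGroups ModularForm ComplexConjugate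

open CongruenceSubgroup Complex Literature.NumberTheory.EllipticCurves
  Literature.NumberTheory.EllipticCurves.ModularForms
  Summit.BirchSwinnertonDyer.Rank1Residual.ManinAdditive.Gamma1Lattice
  Summit.BirchSwinnertonDyer.Rank1Residual.ManinAdditive.KatoCurve

namespace Summit.BirchSwinnertonDyer.BirchSwinnertonDyer.Theorems.ManinLocalTwoThree

/-! ### §1 The unipotent units `u_t = 1 + t q^{n-1}` of `ℤ/qⁿ` -/

section Units

variable {q n : ℕ}

/-- `u_s · u_t = u_{s+t}` in `ℤ/qⁿ` for `n ≥ 2` (`q^{2(n-1)} ≡ 0`). -/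
theorem one_add_mul_pow_mul_one_add_mul_pow (hn : 2 ≤ n) (s t : ℕ) :
    ((1 + (s : ZMod (q ^ n)) * (q : ZMod (q ^ n)) ^ (n - 1)) * (1 + (t : ZMod (q ^ n)) * (q : ZMod (q ^ n)) ^ (n - 1)))
      = 1 + ((s + t : ℕ) : ZMod (q ^ n)) * (q : ZMod (q ^ n)) ^ (n - 1) := by
  have hsq : ((q : ZMod (q ^ n)) ^ (n - 1)) * ((q : ZMod (q ^ n)) ^ (n - 1)) = 0 := by
    rw [← pow_add]
    obtain ⟨k, hk⟩ : ∃ k, (n - 1) + (n - 1) = n + k := ⟨n - 2, by omega⟩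
    rw [hk, pow_add, ← Nat.cast_pow, ZMod.natCast_self, zero_mul]
  push_cast
  linear_combination ((s : ZMod (q ^ n)) * t) * hsq

/-- `u_1 ^ t = u_t`. -/
theorem one_add_pow_pow_eq (hn : 2 ≤ n) (t : ℕ) :
    (1 + (q : ZMod (q ^ n)) ^ (n - 1)) ^ t = 1 + (t : ZMod (q ^ n)) * (q : ZMod (q ^ n)) ^ (n - 1) := by
  induction t with
  | zero => simp
  | succ t ih =>
    rw [pow_succ, ih]
    have h := one_add_mul_pow_mul_one_add_mul_pow (q := q) hn t 1
    rw [Nat.cast_one, one_mul] at h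
    rw [h]

/-- `u_q = 1`. -/
theorem one_add_self_mul_pow_eq_one (hn : 1 ≤ n) :
    (1 : ZMod (q ^ n)) + (q : ZMod (q ^ n)) * (q : ZMod (q ^ n)) ^ (n - 1) = 1 := by
  rw [← pow_succ']
  have : n - 1 + 1 = n := by omega
  rw [this, ← Nat.cast_pow, ZMod.natCast_self, add_zero]

/-- `u_t` is a unit (`u_t · u_{q-t} = u_q = 1` for `t ≤ q`; in general `u_t · u_1^{q - t % q} = 1`). -/
theorem isUnit_one_add_mul_pow (hn : 2 ≤ n) (hq : 0 < q) (t : ℕ) :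
    IsUnit (1 + (t : ZMod (q ^ n)) * (q : ZMod (q ^ n)) ^ (n - 1)) := by
  rw [← one_add_pow_pow_eq hn t]
  refine IsUnit.pow t ?_
  have h1 : (1 + (q : ZMod (q ^ n)) ^ (n - 1)) ^ q = 1 := by
    rw [one_add_pow_pow_eq hn q, one_add_self_mul_pow_eq_one (by omega)]
  exact IsUnit.of_pow_eq_one h1 hq.ne'

end Units

/-! ### §2 A primitive character mod `qⁿ` is non-trivial at `u_1 = 1 + q^{n-1}` -/

/-- For a prime `q` and `n ≥ 2`, a PRIMITIVE Dirichlet character mod `qⁿ` satisfies `χ(1 + q^{n-1}) ≠ 1`: every unit `≡ 1 (mod q^{n-1})`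
is a power of `1 + q^{n-1}`, so otherwise `χ` would factor through `q^{n-1}`. [folklore] -/
theorem DirichletCharacter.apply_one_add_pow_ne_one_of_isPrimitive {q n : ℕ} (hq : q.Prime) (hn : 2 ≤ n)
    {χ : DirichletCharacter ℂ (q ^ n)} (hprim : χ.IsPrimitive) :
    χ (1 + (q : ZMod (q ^ n)) ^ (n - 1)) ≠ 1 := by
  haveI : Fact q.Prime := ⟨hq⟩
  haveI : NeZero (q ^ n) := ⟨pow_ne_zero _ hq.ne_zero⟩
  intro h1
  have hdvd : q ^ (n - 1) ∣ q ^ n := pow_dvd_pow q (Nat.sub_le n 1)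
  have hker : (ZMod.unitsMap hdvd).ker ≤ χ.toUnitHom.ker := by
    intro w hw
    -- `w ≡ 1 (mod q^{n-1})`: `w = 1 + t q^{n-1} = u_1^t`
    have hw0 : (((w : ZMod (q ^ n)).val : ℕ) : ZMod (q ^ (n - 1))) = 1 := by
      have h := hw
      rw [MonoidHom.mem_ker, Units.ext_iff, ZMod.unitsMap_val, ← ZMod.natCast_val, Units.val_one] at h
      exact h
    have hw1 : (w : ZMod (q ^ n)).val ≡ 1 [MOD q ^ (n - 1)] := by
      rw [← ZMod.natCast_eq_natCast_iff, Nat.cast_one]; exact hw0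
    set W : ℕ := (w : ZMod (q ^ n)).val with hW
    have hqn1 : 1 < q ^ (n - 1) := Nat.one_lt_pow (by omega) hq.one_lt
    have hWmod : W % q ^ (n - 1) = 1 := by
      have h : W % q ^ (n - 1) = 1 % q ^ (n - 1) := hw1
      rwa [Nat.mod_eq_of_lt hqn1] at h
    have hWdec : W = q ^ (n - 1) * (W / q ^ (n - 1)) + 1 := by
      have := Nat.div_add_mod W (q ^ (n - 1)); omega
    have hwval : (w : ZMod (q ^ n)) = (1 + (q : ZMod (q ^ n)) ^ (n - 1)) ^ (W / q ^ (n - 1)) := by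
      rw [one_add_pow_pow_eq hn]
      calc (w : ZMod (q ^ n)) = ((W : ℕ) : ZMod (q ^ n)) := (ZMod.natCast_zmod_val _).symm
        _ = ((q ^ (n - 1) * (W / q ^ (n - 1)) + 1 : ℕ) : ZMod (q ^ n)) := by rw [← hWdec]
        _ = 1 + ((W / q ^ (n - 1) : ℕ) : ZMod (q ^ n)) * (q : ZMod (q ^ n)) ^ (n - 1) := by push_cast; ring
    rw [MonoidHom.mem_ker, Units.ext_iff, MulChar.coe_toUnitHom, Units.val_one, hwval, map_pow, h1, one_pow]
  have hfac : χ.FactorsThrough (q ^ (n - 1)) := (DirichletCharacter.factorsThrough_iff_ker_unitsMap hdvd).mpr hker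
  have hcond : χ.conductor ≤ q ^ (n - 1) := Nat.sInf_le ((DirichletCharacter.mem_conductorSet_iff χ).mpr hfac)
  rw [(DirichletCharacter.isPrimitive_def χ).mp hprim] at hcond
  have hlt : q ^ (n - 1) < q ^ n := Nat.pow_lt_pow_right hq.one_lt (by omega)
  omega

/-- `Σ_{t<q} χ(u_t) = 0` for a primitive `χ` mod `qⁿ`, `n ≥ 2` (geometric sum of the `q`-th root of unity `χ(u_1) ≠ 1`). -/
theorem DirichletCharacter.sum_apply_one_add_mul_pow_eq_zero {q n : ℕ} (hq : q.Prime) (hn : 2 ≤ n)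
    {χ : DirichletCharacter ℂ (q ^ n)} (hprim : χ.IsPrimitive) :
    ∑ t ∈ Finset.range q, χ (1 + (t : ZMod (q ^ n)) * (q : ZMod (q ^ n)) ^ (n - 1)) = 0 := by
  set x : ℂ := χ (1 + (q : ZMod (q ^ n)) ^ (n - 1)) with hx
  have hx1 : x ≠ 1 := DirichletCharacter.apply_one_add_pow_ne_one_of_isPrimitive hq hn hprim
  have hxq : x ^ q = 1 := by
    rw [hx, ← map_pow, one_add_pow_pow_eq hn q, one_add_self_mul_pow_eq_one (by omega), map_one]
  have hsum : ∑ t ∈ Finset.range q, χ (1 + (t : ZMod (q ^ n)) * (q : ZMod (q ^ n)) ^ (n - 1)) =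
      ∑ t ∈ Finset.range q, x ^ t := by
    refine Finset.sum_congr rfl fun t _ ↦ ?_
    rw [hx, ← map_pow, one_add_pow_pow_eq hn t]
  rw [hsum]
  have h := geom_sum_mul x q
  rw [hxq, sub_self] at h
  exact (mul_eq_zero.mp h).resolve_right (sub_ne_zero.mpr hx1)

/-! ### §3 The `ℤ/m` bookkeeping (private copies; cf. `…TowerDescent`) -/

variable {N : ℕ} [NeZero N] (f : CuspForm (Gamma0 N) 2)

section Level

variable {m : ℕ} [NeZero m]

omit [NeZero N] [NeZero m] in
/-- `y_0 = 0`. -/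
private theorem yT_zero : modularSymbol f (((0 : ZMod m).val : ℚ) / m) - modularSymbol f 0 = 0 := by
  simp [ZMod.val_zero]

omit [NeZero m] in
/-- `y_a ∈ Λ_f` for `m` prime to `N`. -/
private theorem yT_mem_periodLattice (hNm : IsCoprime (N : ℤ) m) (a : ZMod m) :
    modularSymbol f ((a.val : ℚ) / m) - modularSymbol f 0 ∈ periodLattice f := by
  have e : ((a.val : ℤ) : ℚ) / ((m : ℤ) : ℚ) = (a.val : ℚ) / m := by push_cast; rfl
  rw [← e]
  exact modularSymbol_intCast_div_sub_zero_mem_periodLattice f hNm _ dvd_rfl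

/-- `y_{−a} = conj y_a` for real `f`. -/
private theorem yT_neg (hreal : ∀ n, (cuspCoeff f n).im = 0) (a : ZMod m) :
    modularSymbol f (((-a).val : ℚ) / m) - modularSymbol f 0 =
      conj (modularSymbol f ((a.val : ℚ) / m) - modularSymbol f 0) := by
  have h0 : conj (modularSymbol f 0) = modularSymbol f 0 := by
    have := modularSymbol_neg_eq_conj_holds f hreal 0
    rw [neg_zero] at this
    exact this.symm
  by_cases ha : a = 0
  · rw [ha, neg_zero, yT_zero, map_zero]
  · have hval : (-a).val = m - a.val := by rw [ZMod.neg_val, if_neg ha]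
    have hlt : a.val ≤ m := (ZMod.val_lt a).le
    have hmQ : (m : ℚ) ≠ 0 := by exact_mod_cast (NeZero.ne m)
    have e : (((-a).val : ℚ) / m) = -((a.val : ℚ) / m) + ((1 : ℤ) : ℚ) := by
      rw [hval, Nat.cast_sub hlt]
      field_simp
      push_cast
      ring
    rw [e, modularSymbol_add_intCast_holds f, modularSymbol_neg_eq_conj_holds f hreal, map_sub, h0]

/-- `{∞, b/m} = {∞, (b mod m)/m}`. -/
private theorem modularSymbol_intCast_div_eq_val' (b : ℤ) :
    modularSymbol f ((b : ℚ) / ((m : ℤ) : ℚ)) = modularSymbol f ((((b : ZMod m)).val : ℚ) / m) := by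
  have hmQ : (m : ℚ) ≠ 0 := by exact_mod_cast (NeZero.ne m)
  have hv : (((b : ZMod m)).val : ℤ) = b % m := ZMod.val_intCast b
  have hb : (b : ℚ) / ((m : ℤ) : ℚ) = ((((b : ZMod m)).val : ℚ) / m) + ((b / m : ℤ) : ℚ) := by
    have e1 : (b : ℚ) = ((b % m : ℤ) : ℚ) + (m : ℚ) * ((b / m : ℤ) : ℚ) := by
      exact_mod_cast (Int.emod_add_mul_ediv b m).symm
    have e2 : ((((b : ZMod m)).val : ℚ)) = ((b % m : ℤ) : ℚ) := by exact_mod_cast hv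
    rw [e2, e1]
    push_cast
    field_simp
  rw [hb, modularSymbol_add_intCast_holds f]

/-- Half-sum identity: `2 · S_χ = Σ_a χ(a)·(y_a + ȳ_a)` for even `χ ≠ 1` and real `f`. -/
private theorem two_mul_S_eq' (hreal : ∀ n, (cuspCoeff f n).im = 0) {χ : DirichletCharacter ℂ m}
    (hχ : χ ≠ 1) (hev : χ.Even) :
    2 * twistedSymbolSum f χ = ∑ a : ZMod m, χ a * ((modularSymbol f ((a.val : ℚ) / m) - modularSymbol f 0) +
      conj (modularSymbol f ((a.val : ℚ) / m) - modularSymbol f 0)) := by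
  have hS : twistedSymbolSum f χ = ∑ a : ZMod m, χ a * (modularSymbol f ((a.val : ℚ) / m) - modularSymbol f 0) := by
    have : ∑ a : ZMod m, χ a * (modularSymbol f ((a.val : ℚ) / m) - modularSymbol f 0) =
        ∑ a : ZMod m, χ a * modularSymbol f ((a.val : ℚ) / m) - (∑ a : ZMod m, χ a) * modularSymbol f 0 := by
      simp only [mul_sub, Finset.sum_sub_distrib, Finset.sum_mul]
    rw [this, χ.sum_eq_zero_of_ne_one hχ, zero_mul, sub_zero]
    rfl
  have hS' : twistedSymbolSum f χ =
      ∑ a : ZMod m, χ a * conj (modularSymbol f ((a.val : ℚ) / m) - modularSymbol f 0) := by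
    rw [hS]
    refine Fintype.sum_equiv (Equiv.neg (ZMod m)) _ _ fun a ↦ ?_
    rw [Equiv.neg_apply, hev.eval_neg, yT_neg f hreal, Complex.conj_conj]
  rw [two_mul]
  nth_rewrite 1 [hS]
  rw [hS', ← Finset.sum_add_distrib]
  refine Finset.sum_congr rfl fun a _ ↦ ?_
  ring

end Level

/-! ### §4 The converse duality at level `n` -/

variable {f}

/-- **Fourier duality, «⟹» (MEMO-an §71.3): a UNIT even twisted value at a PRIMITIVE character of conductor `qⁿ` forces a level-`n`
tower difference with plus part `≢ 0 (mod p)`.**  `f` a rational newform, `q ∤ N` an odd prime, `q ≠ p`, `n ≥ 2`. -/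
theorem exists_levelDifference_plus_not_dvd_of_unitTwist (hf : IsNewform0 f) (hQ : coeffField f = ⊥)
    {p : ℕ} (hp : p.Prime) {q : ℕ} [Fact q.Prime] (hq2 : q ≠ 2) (hqp : q ≠ p) (hqN : ¬ q ∣ N) {n : ℕ} (hn : 2 ≤ n)
    {χ : DirichletCharacter ℂ (q ^ n)} (hprim : χ.IsPrimitive) (hev : χ.Even) {r : ℂ}
    (hr : twistedSymbolSum f χ = r * (plusPeriod f : ℂ))
    (hunit : ∀ s : ℕ, ¬ p ∣ s → ¬ IsIntegral ℤ ((s : ℂ) * r / p)) :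
    ∃ b t : ℤ, ¬ (q : ℤ) ∣ b ∧ ∃ j : ℤ,
      (modularSymbol f (((b + t * (q : ℤ) ^ (n - 1) : ℤ) : ℚ) / (q : ℚ) ^ n) - modularSymbol f ((b : ℚ) / (q : ℚ) ^ n)) +
        conj (modularSymbol f (((b + t * (q : ℤ) ^ (n - 1) : ℤ) : ℚ) / (q : ℚ) ^ n) -
          modularSymbol f ((b : ℚ) / (q : ℚ) ^ n)) = (j : ℂ) * (plusPeriod f : ℂ) ∧ ¬ (p : ℤ) ∣ j := by
  have hq : q.Prime := Fact.out
  have hq3 : 3 ≤ q := by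
    rcases hq.eq_two_or_odd' with h | h
    · exact absurd h hq2
    · have := hq.two_le; rcases h with ⟨k, hk⟩; omega
  haveI : NeZero (q ^ n) := ⟨pow_ne_zero _ hq.ne_zero⟩
  obtain ⟨hpos, -⟩ := plusPeriod_pos_and_realPeriods_eq isZLattice_periodLattice_holds hf hQ
  have hΩ : (plusPeriod f : ℂ) ≠ 0 := by exact_mod_cast hpos.ne'
  have hreal : ∀ n, (cuspCoeff f n).im = 0 := cuspCoeff_im_eq_zero_of_coeffField_eq_bot hQ
  have hNm : IsCoprime (N : ℤ) ((q ^ n : ℕ) : ℤ) := by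
    rw [Nat.cast_pow]
    exact IsCoprime.pow_right (Nat.isCoprime_iff_coprime.mpr
      (Nat.coprime_comm.mp ((Nat.Prime.coprime_iff_not_dvd hq).mpr hqN)))
  have hχ1 : χ ≠ 1 := by
    rintro rfl
    rw [DirichletCharacter.isPrimitive_def, DirichletCharacter.conductor_one] at hprim
    have : 1 < q ^ n := Nat.one_lt_pow (by omega) hq.one_lt
    omega
  by_contra hcon
  push Not at hcon
  -- the integer-valued even function `F`
  have hF : ∀ a : ZMod (q ^ n), ∃ k : ℤ, (modularSymbol f ((a.val : ℚ) / (q ^ n : ℕ)) - modularSymbol f 0) +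
      conj (modularSymbol f ((a.val : ℚ) / (q ^ n : ℕ)) - modularSymbol f 0) = (k : ℂ) * (plusPeriod f : ℂ) :=
    fun a ↦ exists_int_add_conj_eq_mul_plusPeriod hf hQ (yT_mem_periodLattice f hNm a)
  choose F hF using hF
  have hFeven : ∀ a : ZMod (q ^ n), F (-a) = F a := by
    intro a
    have h1 := hF (-a)
    rw [yT_neg f hreal, Complex.conj_conj, add_comm, hF a] at h1
    exact_mod_cast (mul_right_cancel₀ hΩ h1).symm
  -- `p ∣ F(u_t · a) − F(a)` for every unit `a` and every `t`
  have hstep : ∀ (a : ZMod (q ^ n)), IsUnit a → ∀ t : ℕ,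
      (p : ℤ) ∣ F ((1 + (t : ZMod (q ^ n)) * (q : ZMod (q ^ n)) ^ (n - 1)) * a) - F a := by
    intro a ha t
    have hacop : (a.val).Coprime (q ^ n) := (ZMod.isUnit_iff_coprime a.val (q ^ n)).mp (by rwa [ZMod.natCast_zmod_val])
    have hqa : ¬ (q : ℤ) ∣ (a.val : ℤ) := by
      intro h
      have h' : q ∣ a.val := by exact_mod_cast h
      have := Nat.Coprime.coprime_dvd_left h' hacop
      rw [Nat.coprime_pow_right_iff (by omega) q q, Nat.coprime_self] at this
      exact hq.one_lt.ne' this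
    -- the two residues as integers `b = a.val`, `b + (t·a.val) q^{n-1}`
    have hmq : (((q ^ n : ℕ) : ℤ) : ℚ) = (q : ℚ) ^ n := by push_cast; ring
    have hres : (((a.val : ℤ) + (t * a.val : ℤ) * (q : ℤ) ^ (n - 1) : ℤ) : ZMod (q ^ n)) =
        ((1 + (t : ZMod (q ^ n)) * (q : ZMod (q ^ n)) ^ (n - 1)) * a) := by
      push_cast
      rw [ZMod.natCast_zmod_val]
      ring
    have hj := hF (((1 + (t : ZMod (q ^ n)) * (q : ZMod (q ^ n)) ^ (n - 1)) * a))
    have hja := hF a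
    -- the level-`n` difference `{∞,(b + t' q^{n-1})/qⁿ} − {∞, b/qⁿ}` and its plus part
    have key := hcon (a.val : ℤ) (t * a.val : ℤ) hqa (F ((1 + (t : ZMod (q ^ n)) * (q : ZMod (q ^ n)) ^ (n - 1)) * a) - F a)
    apply key
    rw [← hmq, modularSymbol_intCast_div_eq_val' f ((a.val : ℤ) + (t * a.val : ℤ) * (q : ℤ) ^ (n - 1)),
      modularSymbol_intCast_div_eq_val' f (a.val : ℤ), hres]
    have ea : (((a.val : ℤ) : ZMod (q ^ n)).val : ℚ) = (a.val : ℚ) := by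
      rw [Int.cast_natCast, ZMod.natCast_zmod_val]
    rw [ea]
    have e : modularSymbol f (((((1 + (t : ZMod (q ^ n)) * (q : ZMod (q ^ n)) ^ (n - 1)) * a)).val : ℚ) / (q ^ n : ℕ)) -
        modularSymbol f ((a.val : ℚ) / (q ^ n : ℕ)) =
        (modularSymbol f (((((1 + (t : ZMod (q ^ n)) * (q : ZMod (q ^ n)) ^ (n - 1)) * a)).val : ℚ) / (q ^ n : ℕ)) -
            modularSymbol f 0) - (modularSymbol f ((a.val : ℚ) / (q ^ n : ℕ)) - modularSymbol f 0) := by ring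
    rw [e, map_sub, sub_add_sub_comm, hj, hja, Int.cast_sub, sub_mul]
  -- `g_t(a) := (F(u_t a) − F(a))/p`, exact on units
  set g : ℕ → ZMod (q ^ n) → ℤ := fun t a ↦ (F ((1 + (t : ZMod (q ^ n)) * (q : ZMod (q ^ n)) ^ (n - 1)) * a) - F a) / p
    with hg
  have hgF : ∀ (a : ZMod (q ^ n)), IsUnit a → ∀ t : ℕ,
      F ((1 + (t : ZMod (q ^ n)) * (q : ZMod (q ^ n)) ^ (n - 1)) * a) - F a = p * g t a :=
    fun a ha t ↦ (Int.mul_ediv_cancel' (hstep a ha t)).symm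
  have hgeven : ∀ t a, g t (-a) = g t a := by
    intro t a; simp only [hg, mul_neg, hFeven]
  -- the averaged identity `q · F̂(χ) = p · Σ_a h(a)`
  set h : ZMod (q ^ n) → ℂ := fun a ↦ χ a * ∑ t ∈ Finset.range q,
    χ (1 + (t : ZMod (q ^ n)) * (q : ZMod (q ^ n)) ^ (n - 1)) * (g t a : ℂ) with hh
  have hreidx : ∀ t : ℕ, ∑ a : ZMod (q ^ n), χ ((1 + (t : ZMod (q ^ n)) * (q : ZMod (q ^ n)) ^ (n - 1)) * a) *
      (F ((1 + (t : ZMod (q ^ n)) * (q : ZMod (q ^ n)) ^ (n - 1)) * a) : ℂ) = ∑ a : ZMod (q ^ n), χ a * (F a : ℂ) := by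
    intro t
    obtain ⟨U, hU⟩ := isUnit_one_add_mul_pow (q := q) hn hq.pos t
    rw [← hU]
    exact Equiv.sum_comp U.mulLeft (fun a ↦ χ a * (F a : ℂ))
  have hzero := DirichletCharacter.sum_apply_one_add_mul_pow_eq_zero hq hn hprim
  have havg : (q : ℂ) * ∑ a : ZMod (q ^ n), χ a * (F a : ℂ) = (p : ℂ) * ∑ a : ZMod (q ^ n), h a := by
    calc (q : ℂ) * ∑ a : ZMod (q ^ n), χ a * (F a : ℂ)
        = ∑ t ∈ Finset.range q, ∑ a : ZMod (q ^ n), χ ((1 + (t : ZMod (q ^ n)) * (q : ZMod (q ^ n)) ^ (n - 1)) * a) *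
            (F ((1 + (t : ZMod (q ^ n)) * (q : ZMod (q ^ n)) ^ (n - 1)) * a) : ℂ) := by
          rw [Finset.sum_congr rfl (fun t _ ↦ hreidx t), Finset.sum_const, Finset.card_range, nsmul_eq_mul]
      _ = ∑ a : ZMod (q ^ n), ∑ t ∈ Finset.range q, χ ((1 + (t : ZMod (q ^ n)) * (q : ZMod (q ^ n)) ^ (n - 1)) * a) *
            (F ((1 + (t : ZMod (q ^ n)) * (q : ZMod (q ^ n)) ^ (n - 1)) * a) : ℂ) := Finset.sum_comm
      _ = ∑ a : ZMod (q ^ n), (χ a * ∑ t ∈ Finset.range q,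
            χ (1 + (t : ZMod (q ^ n)) * (q : ZMod (q ^ n)) ^ (n - 1)) *
              ((F ((1 + (t : ZMod (q ^ n)) * (q : ZMod (q ^ n)) ^ (n - 1)) * a) : ℂ) - (F a : ℂ)) +
            χ a * (F a : ℂ) * ∑ t ∈ Finset.range q, χ (1 + (t : ZMod (q ^ n)) * (q : ZMod (q ^ n)) ^ (n - 1))) := by
          refine Finset.sum_congr rfl fun a _ ↦ ?_
          rw [Finset.mul_sum, Finset.mul_sum, ← Finset.sum_add_distrib]
          refine Finset.sum_congr rfl fun t _ ↦ ?_
          rw [map_mul]; ring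
      _ = ∑ a : ZMod (q ^ n), χ a * ∑ t ∈ Finset.range q,
            χ (1 + (t : ZMod (q ^ n)) * (q : ZMod (q ^ n)) ^ (n - 1)) *
              ((F ((1 + (t : ZMod (q ^ n)) * (q : ZMod (q ^ n)) ^ (n - 1)) * a) : ℂ) - (F a : ℂ)) := by
          simp only [hzero, mul_zero, add_zero]
      _ = (p : ℂ) * ∑ a : ZMod (q ^ n), h a := by
          rw [Finset.mul_sum]
          refine Finset.sum_congr rfl fun a _ ↦ ?_
          by_cases ha : IsUnit a
          · rw [hh]
            simp only
            rw [Finset.mul_sum, Finset.mul_sum, Finset.mul_sum]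
            refine Finset.sum_congr rfl fun t _ ↦ ?_
            have := hgF a ha t
            rw [← Int.cast_sub, this]; push_cast; ring
          · rw [hh]
            simp only [χ.map_nonunit ha, zero_mul, mul_zero]
  -- pairing: `Σ_a h(a) = 2 G`
  have hpair := sum_eq_two_mul_sum_filter_of_neg h
    (fun a ↦ by simp only [hh, hev.eval_neg, hgeven])
    (fun a ha ↦ by
      by_cases hu : IsUnit a
      · exact absurd ha (ne_neg_of_isUnit (lt_of_lt_of_le (by omega) (Nat.le_self_pow (by omega) q)) hu)
      · simp only [hh, χ.map_nonunit hu, zero_mul])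
  set G : ℂ := ∑ a ∈ Finset.univ.filter (fun a : ZMod (q ^ n) ↦ a.val < (-a).val), h a with hG
  have hGI : IsIntegral ℤ G := IsIntegral.sum _ fun a _ ↦
    (DirichletCharacter.isIntegral_apply χ a).mul (IsIntegral.sum _ fun t _ ↦
      (DirichletCharacter.isIntegral_apply χ _).mul (isIntegral_algebraMap (R := ℤ) (x := g t a)))
  -- `F̂ = 2 r`
  have h2 := two_mul_S_eq' f hreal hχ1 hev
  simp_rw [hF, ← mul_assoc, ← Finset.sum_mul] at h2
  rw [hr] at h2
  have hFr : ∑ a : ZMod (q ^ n), χ a * (F a : ℂ) = 2 * r := by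
    have : (2 * r) * (plusPeriod f : ℂ) = (∑ a : ZMod (q ^ n), χ a * (F a : ℂ)) * (plusPeriod f : ℂ) := by
      rw [← h2]; ring
    exact (mul_right_cancel₀ hΩ this).symm
  -- `q r = p G`
  rw [hFr, hpair] at havg
  have hqr : (q : ℂ) * r = (p : ℂ) * G := by
    have : 2 * ((q : ℂ) * r) = 2 * ((p : ℂ) * G) := by rw [← mul_assoc, mul_comm 2 (q : ℂ), mul_assoc, havg]; ring
    exact mul_left_cancel₀ two_ne_zero this
  have hp0 : (p : ℂ) ≠ 0 := by exact_mod_cast hp.ne_zero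
  refine hunit q (fun hd ↦ hqp ((Nat.prime_dvd_prime_iff_eq hp hq).mp hd).symm) ?_
  rw [hqr, mul_div_cancel_left₀ G hp0]
  exact hGI

end Summit.BirchSwinnertonDyer.BirchSwinnertonDyer.Theorems.ManinLocalTwoThree

end
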